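import Summits.Ventures.QEC.CircuitDistance.PortK2DataBB144Z
import Summits.Ventures.QEC.CircuitDistance.K2Chunks
import HarnessLib

/-!
# K2(`[[144,12,12]]`) chunk module — COMPUTATIONAL (native_decide; `Lean.ofReduceBool`)

Cell `qec`, CDX, R146/R152 STEP 1 («computational» header; `ofReduceBool` confined to these chunk modules). Checker of record
`K2.K2Data` (qec-cdx-type-1, PortK2Check); data module of record `PortK2DataBB144X/Z` (p669158/9, crit-1 data audit PASS
2026-08-28T21:20Z); chunk glue `K2Chunks` (idea-1 g2). Cube 0, child 11: leaf group 4 of 6.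
Leaf theorems: the K2 DFS accepts below one descendant state of pivot cube 0 (sector Z); sizes are exact DFS visit counts
(eng-1 g2 `k2count.c`), capped so that the gate's native-axiom audit re-verifies every leaf in place. Assemblies re-derive the
child lists in the kernel (`decide`) and end in the literal cube fact `d144Z.cube (Ts144Z.getD 0 []) (0) (lives144Z.getD 0 0) = true`
(the `hcubes` hypothesis of `K2Inst.k2_complete`). Emitted by qec-cdx-eng-1 g2 (`gen2.py`, idea-1's `gen_k2chunks_from_lean.py` lineage).
-/

namespace Summit.Ventures.QEC.CircuitDistance.K2

set_option maxRecDepth 100000 in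
set_option maxHeartbeats 0 in
set_option exponentiation.threshold 1024 in
/-- K2(144) chunk fact `cube144Z0_ch11_9` (311414 DFS visits; see the module docstring). -/
theorem cube144Z0_ch11_9 : app5 (d144Z.dfs (Ts144Z.getD 0 []) 6) (2436142297124888936704, 1676, 421249166674240719413085125491387653861729993392693466416635969537, 3, 2348542582773833227889480596789337027375682127659153196077426007636290036687456880729725469052214818839199708) = true := by native_decide

set_option maxRecDepth 100000 in
set_option maxHeartbeats 0 in
set_option exponentiation.threshold 1024 in
/-- K2(144) chunk fact `cube144Z0_ch11_10` (279446 DFS visits; see the module docstring). -/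
theorem cube144Z0_ch11_10 : app5 (d144Z.dfs (Ts144Z.getD 0 []) 6) (74959055691257497600, 3724, 421249166674994994562105055163860902789155536194005814578335711233, 3, 2348542582773833227889480596789337027375682127659153195311178237203345607508283367154570877242845257747398620) = true := by native_decide

set_option maxRecDepth 100000 in
set_option maxHeartbeats 0 in
set_option exponentiation.threshold 1024 in
/-- K2(144) chunk fact `cube144Z0_ch11_11` (676239 DFS visits; see the module docstring). -/
theorem cube144Z0_ch11_11 : app5 (d144Z.dfs (Ts144Z.getD 0 []) 6) (224841138273123303424, 4, 1263747500022686240375016332204045187826741144806589335051731730433, 3, 2348542582773833227889480596789337027375681285160819846853684653859124138144824815993807672849955223259578332) = true := by native_decide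

set_option maxRecDepth 100000 in
set_option maxHeartbeats 0 in
set_option exponentiation.threshold 1024 in
/-- K2(144) chunk fact `cube144Z0_ch11_12` (400618 DFS visits; see the module docstring). -/
theorem cube144Z0_ch11_12 : app5 (d144Z.dfs (Ts144Z.getD 0 []) 6) (2436178888871842415104, 748, 13901222500249548644125179654244497066094152592872482685569049034753, 3, 2348542582773833227889480596789337027375667805187486271533787320351580628329487997421596402563714671454453724) = true := by native_decide

set_option maxRecDepth 100000 in
set_option maxHeartbeats 0 in
set_option exponentiation.threshold 1024 in
/-- K2(144) chunk fact `cube144Z0_ch11_13` (276929 DFS visits; see the module docstring). -/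
theorem cube144Z0_ch11_13 : app5 (d144Z.dfs (Ts144Z.getD 0 []) 6) (77300927496280115200, 2734, 863139542515494702176136154895362863285664201902900515840332771885057, 3, 2348542582773833227889480596789337027374805086894137451060357975868796000147931608800075104244319355926478812) = true := by native_decide
end Summit.Ventures.QEC.CircuitDistance.K2
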